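import Literature.IUT.LogVolume.UnitLogBallTorsionCensus
import Literature.IUT.LogVolume.UnitLogBallVolumeCriterion
import Literature.IUT.LogVolume.RescaledCompletionInvariants
import Literature.IUT.LogVolume.LocalDegreeBridge
import HarnessLib

/-!
# Branch E TEST support — square roots at places of residue degree one, and the `ℚ_3(√3)`-shape
# (local arithmetic for the residual class of R-J row Y-26)

Proof-only file (abc-iut cell, D-0079 R-J «Joshi Y-discharge census», row Y-26; seat abc-iut-E-t43, gen 4; 0 definitions, no `Prop`
fact, FACT rows used: none; classical local algebra only — nothing disputed is used or asserted).  It supplies the arithmetic consumed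
by `Joshi/TestGenuinePinsVacuityQuadratic.lean` (the global corollaries of abc-iut-E-t44's genuine-carrier pins vacuity p445249 /
p446217 / p446474 for fields WITHOUT `√−1`), in the currency of abc-iut-S7's `RescaledCompletion F p v hv` and abc-iut-S1's
`absRamificationIdx` / `residueDegree` / `torsionPExp`:

* `exists_nat_norm_sub_lt_one_of_residueDegree_eq_one` — at residue degree `1` every local integer is congruent mod `𝔪` to one of
  `0, …, p − 1` (the residue field has `p` elements);
* `not_sq_eq_of_five_mod_eight` — a `ℚ_2`-field of residue degree `1` contains NO `ρ` with `ρ² = d`, `d ≡ 5 (mod 8)`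
  (`ω = (1 + ρ)/2` is a local integer with `ω(ω − 1) = (d − 1)/4` odd, while `ω ≡ 0, 1` forces `ω(ω − 1) ≡ 0`);
* `not_sq_eq_neg_one_three` — a `ℚ_3`-field of residue degree `1` contains NO `√−1`;
* `two_le_ramificationIdx_of_norm_mem_Ioo'` (`q⁻¹ < ‖x‖ < 1 ⇒ e(v|q) ≥ 2`, any prime `q`; the `q = 2` case is abc-iut-w4-d017's),
  `two_le_ramificationIdx_of_sq_eq_of_dvd` (`F ∋ √d`, `q ∥ d` ⇒ `e(v|q) ≥ 2`),
  **`two_le_inertiaDeg_of_sq_eq_five_mod_eight`** (`F ∋ √d`, `d ≡ 5 (mod 8)` ⇒ `f(v|2) ≥ 2` at EVERY `v ∣ 2` — e.g. every `F ∋ ζ_3`),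
  **`closedBall_one_ne_zpow_smul_logUnits_of_sq_eq_three`** (`[F : ℚ] = 2`, `F ∋ √3`, `v ∣ 3`: `e = 2`, `f = 1`, no `ζ_3` in `F_v` —
  `ζ_3` and `√3` would give `√−1 = (2ζ_3 + 1)√3/3` — so by abc-iut-w5-d039's volume constraint at `m = 0` the unit ball of `F_v` is
  no `3^k·log_3(𝒪_v^×)`: the `ℚ_3(√3)`-shape lies OUTSIDE the `ℚ_3(ζ_3)`-exception of the mover census).

[cite: NeukirchANT1999, Ch. II Prop. (5.3), (5.7), (6.8)]
-/

noncomputable section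

open Set Function NumberField IsDedekindDomain Metric
open scoped Pointwise

namespace Summit.ABC.IUTFork.Joshi

open Literature.IUT.LogVolume Literature.NumberTheory.NumberFields
open Literature.NumberTheory.GaloisRepresentations.Ultrametric

namespace GenuinePinsResidual

/-! ## 1. Local fields of residue degree one -/

section LocalField

variable (p : ℕ) [Fact p.Prime] (K : Type*) [NontriviallyNormedField K] [NormedAlgebra ℚ_[p] K]
  [IsUltrametricDist K] [ProperSpace K]

omit [IsUltrametricDist K] [ProperSpace K] in
/-- Norms of rational integers read in `K`: `‖(z : K)‖ = ‖z‖_p`. [cite: NeukirchANT1999, Ch. II Prop. (5.3)] -/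
theorem norm_intCast_eq (z : ℤ) : ‖(z : K)‖ = ‖(z : ℚ_[p])‖ := by
  rw [← map_intCast (algebraMap ℚ_[p] K) z, norm_algebraMap']

open scoped NormedField in
open IsLocalRing in
/-- **Residue degree one: every local integer is congruent to a rational integer** — the residue field has `p` elements,
so it is the image of `{0, …, p − 1}`. [cite: NeukirchANT1999, Ch. II Prop. (5.3)] -/
theorem exists_nat_norm_sub_lt_one_of_residueDegree_eq_one (hf : residueDegree p K = 1) {x : K} (hx : ‖x‖ ≤ 1) :
    ∃ n : ℕ, n < p ∧ ‖x - n‖ < 1 := by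
  classical
  have hp : p.Prime := Fact.out
  have hcard : Nat.card (ResidueField (Valued.integer K)) = p := by
    rw [card_residueField p K, hf, pow_one]
  haveI : Finite (ResidueField (Valued.integer K)) :=
    Nat.finite_of_card_ne_zero (by rw [hcard]; exact hp.ne_zero)
  letI : Fintype (ResidueField (Valued.integer K)) := Fintype.ofFinite _
  haveI := charP_residueField p K
  set g : Fin p → ResidueField (Valued.integer K) := fun i => ((i : ℕ) : ResidueField (Valued.integer K)) with hg
  have hinj : Function.Injective g := by
    intro i j hij
    have h := (CharP.natCast_eq_natCast (ResidueField (Valued.integer K)) p).1 hij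
    have h' : (i : ℕ) % p = (j : ℕ) % p := h
    rw [Nat.mod_eq_of_lt i.isLt, Nat.mod_eq_of_lt j.isLt] at h'
    exact Fin.ext h'
  have hc : Fintype.card (Fin p) = Fintype.card (ResidueField (Valued.integer K)) := by
    rw [Fintype.card_fin, ← Nat.card_eq_fintype_card, hcard]
  have hsurj : Function.Surjective g := ((Fintype.bijective_iff_injective_and_card g).mpr ⟨hinj, hc⟩).2
  set x' : Valued.integer K := ⟨x, Valued.integer.mem_iff.mpr hx⟩ with hx'
  obtain ⟨i, hi⟩ := hsurj (residue (Valued.integer K) x')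
  refine ⟨i, i.isLt, ?_⟩
  have hm : x' - ((i : ℕ) : Valued.integer K) ∈ maximalIdeal (Valued.integer K) := by
    rw [← residue_eq_zero_iff, map_sub, map_natCast, ← hi, hg, sub_self]
  rw [mem_maximalIdeal_iff_norm_lt_one] at hm
  exact hm

/-- **A `ℚ_2`-field of residue degree `1` contains no `√d`, `d ≡ 5 (mod 8)`**: `ω = (1 + √d)/2` is a local integer with
`ω(ω − 1) = (d − 1)/4` odd, while `ω ≡ 0` or `1` forces `ω(ω − 1) ≡ 0`. [cite: NeukirchANT1999, Ch. II Prop. (5.3)] -/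
theorem not_sq_eq_of_five_mod_eight (hp2 : p = 2) (hf : residueDegree p K = 1) {ρ : K} {d : ℤ} (hd : d % 8 = 5)
    (hρ : ρ ^ 2 = (d : K)) : False := by
  subst hp2
  set c : ℤ := (d - 1) / 4 with hcdef
  have hdc : d = 4 * c + 1 := by omega
  have hc : ¬ (2 : ℤ) ∣ c := by omega
  have h2 : ‖(2 : K)‖ = 2⁻¹ := by exact_mod_cast norm_prime 2 K
  have h20 : (2 : K) ≠ 0 := fun h => by rw [h, norm_zero] at h2; norm_num at h2
  set ω : K := (1 + ρ) / 2 with hωdef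
  have hω : ω * (ω - 1) = (c : K) := by
    have h4 : (ρ ^ 2 - 1) = 4 * (c : K) := by
      rw [hρ, hdc]; push_cast; ring
    rw [hωdef]
    field_simp
    linear_combination h4
  have hcle : ‖(c : K)‖ ≤ 1 := by rw [norm_intCast_eq 2 K]; exact Padic.norm_int_le_one c
  -- `ω` is a local integer
  have hω1 : ‖ω‖ ≤ 1 := by
    by_contra hlt
    rw [not_le] at hlt
    have hsub : ‖ω - 1‖ = ‖ω‖ := by
      rw [sub_eq_add_neg]
      have hne : ‖ω‖ ≠ ‖(-1 : K)‖ := by rw [norm_neg, norm_one]; exact hlt.ne'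
      rw [IsUltrametricDist.norm_add_eq_max_of_norm_ne_norm hne, norm_neg, norm_one, max_eq_left hlt.le]
    have h := congrArg (‖·‖) hω
    simp only [norm_mul, hsub] at h
    have : (1 : ℝ) < ‖ω‖ * ‖ω‖ := by nlinarith
    linarith
  obtain ⟨n, hn2, hn⟩ := exists_nat_norm_sub_lt_one_of_residueDegree_eq_one 2 K hf hω1
  have hfac : (ω - n) * (ω + n - 1) = (c : K) := by
    interval_cases n
    · rw [Nat.cast_zero, sub_zero, add_zero, hω]
    · rw [Nat.cast_one, add_sub_cancel_right, mul_comm, hω]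
  have hle : ‖ω + n - 1‖ ≤ 1 := by
    have hn1 : ‖(n : K)‖ ≤ 1 := by
      rw [norm_natCast_eq_padicNorm 2 K]; exact_mod_cast Padic.norm_int_le_one (p := 2) n
    rw [sub_eq_add_neg]
    refine (IsUltrametricDist.norm_add_le_max _ _).trans (max_le ?_ (by rw [norm_neg, norm_one]))
    exact (IsUltrametricDist.norm_add_le_max _ _).trans (max_le hω1 hn1)
  have hclt : ‖(c : K)‖ < 1 := by
    rw [← hfac, norm_mul]
    calc ‖ω - n‖ * ‖ω + n - 1‖ ≤ ‖ω - n‖ * 1 :=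
          mul_le_mul_of_nonneg_left hle (norm_nonneg _)
      _ < 1 := by rw [mul_one]; exact hn
  rw [norm_intCast_eq 2 K, Padic.norm_intCast_lt_one_iff] at hclt
  exact hc (by exact_mod_cast hclt)

/-- **A `ℚ_3`-field of residue degree `1` contains no `√−1`** (`−1` is no square mod `3`). [cite: NeukirchANT1999, Ch. II Prop. (5.3)] -/
theorem not_sq_eq_neg_one_three (hp3 : p = 3) (hf : residueDegree p K = 1) {u : K} (hu : u ^ 2 = -1) : False := by
  subst hp3
  have hu1 : ‖u‖ = 1 := by
    have h : ‖u‖ ^ 2 = 1 := by rw [← norm_pow, hu, norm_neg, norm_one]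
    exact (pow_eq_one_iff_of_nonneg (norm_nonneg u) two_ne_zero).mp h
  obtain ⟨n, hn3, hn⟩ := exists_nat_norm_sub_lt_one_of_residueDegree_eq_one 3 K hf hu1.le
  have hn1 : ‖(n : K)‖ ≤ 1 := by
    rw [norm_natCast_eq_padicNorm 3 K]; exact_mod_cast Padic.norm_int_le_one (p := 3) n
  have hfac : (u - n) * (u + n) = -(((n ^ 2 + 1 : ℕ) : ℤ) : K) := by
    push_cast; linear_combination hu
  have hlt : ‖(((n ^ 2 + 1 : ℕ) : ℤ) : K)‖ < 1 := by
    rw [← norm_neg, ← hfac, norm_mul]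
    calc ‖u - n‖ * ‖u + n‖ ≤ ‖u - n‖ * 1 :=
          mul_le_mul_of_nonneg_left ((IsUltrametricDist.norm_add_le_max _ _).trans (max_le hu1.le hn1)) (norm_nonneg _)
      _ < 1 := by rw [mul_one]; exact hn
  rw [norm_intCast_eq 3 K, Padic.norm_intCast_lt_one_iff] at hlt
  interval_cases n <;> norm_num at hlt

end LocalField

/-! ## 2. At a place of a number field -/

section Place

variable {F : Type} [Field F] [NumberField F] (q : ℕ) [hq : Fact q.Prime] (v : HeightOneSpectrum (𝓞 F))
  (hv : ((q : ℕ) : 𝓞 F) ∈ v.asIdeal)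

include hv in
/-- **An element `x ∈ F_v` with `q⁻¹ < ‖x‖ < 1` forces `e(v|q) ≥ 2`** (at `e = 1` the rescaled norms below `1` are `≤ q⁻¹`; the
`q = 2` case is abc-iut-w4-d017's `two_le_ramificationIdx_of_norm_mem_Ioo`). [cite: NeukirchANT1999, Ch. II Prop. (6.8)] -/
theorem two_le_ramificationIdx_of_norm_mem_Ioo' {x : RescaledCompletion F q v hv} (h1 : (q : ℝ)⁻¹ < ‖x‖) (h2 : ‖x‖ < 1) :
    2 ≤ v.asIdeal.ramificationIdx ℤ := by
  rw [← absRamificationIdx_rescaledCompletion F q v hv]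
  set e := absRamificationIdx q (RescaledCompletion F q v hv) with hedef
  have he1 : 1 ≤ e := absRamificationIdx_pos q (RescaledCompletion F q v hv)
  by_contra hlt
  have he : e = 1 := by omega
  have h := norm_le_rpow_of_norm_lt_one q (RescaledCompletion F q v hv) h2
  rw [← hedef, he] at h
  push_cast at h
  rw [div_one, Real.rpow_neg_one] at h
  exact absurd h (not_le.mpr h1)

include hv in
/-- **`F ∋ s` with `s² = d`, `q ∣ d`, `q² ∤ d` ⇒ `e(v|q) ≥ 2`** at every place `v ∣ q` (`‖√d‖ = q^{−1/2}`).
[cite: NeukirchANT1999, Ch. II Prop. (6.8)] -/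
theorem two_le_ramificationIdx_of_sq_eq_of_dvd {s : F} {d : ℤ} (hs : s ^ 2 = d) (h1 : (q : ℤ) ∣ d)
    (h2 : ¬ (q : ℤ) ^ 2 ∣ d) : 2 ≤ v.asIdeal.ramificationIdx ℤ := by
  set K := RescaledCompletion F q v hv
  set ρ : K := RescaledCompletion.of F q v hv (algebraMap F (v.adicCompletion F) s) with hρdef
  have hsq : ρ ^ 2 = (d : K) := by
    rw [hρdef, ← map_pow, ← map_pow, hs, map_intCast, map_intCast]
  -- `‖d‖_q = q⁻¹` (`q ∥ d`)
  have hd : ‖(d : ℚ_[q])‖ = (q : ℝ)⁻¹ := by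
    have hle : ‖(d : ℚ_[q])‖ ≤ (q : ℝ) ^ (-(1 : ℤ)) := by
      have h := (Padic.norm_int_le_pow_iff_dvd d 1).mpr (by rw [pow_one]; exact h1)
      exact_mod_cast h
    have hnot : ¬ ‖(d : ℚ_[q])‖ ≤ (q : ℝ) ^ (-((2 : ℕ) : ℤ)) := by
      rw [Padic.norm_int_le_pow_iff_dvd]
      exact_mod_cast h2
    have hge : (q : ℝ) ^ (-(1 : ℤ)) ≤ ‖(d : ℚ_[q])‖ := by
      have h := (Padic.norm_le_pow_iff_norm_lt_pow_add_one (d : ℚ_[q]) (-((2 : ℕ) : ℤ))).not.mp hnot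
      rw [not_lt, show -((2 : ℕ) : ℤ) + 1 = -(1 : ℤ) by norm_num] at h
      exact h
    rw [zpow_neg, zpow_one] at hle hge
    exact le_antisymm hle hge
  have hn : ‖ρ‖ ^ 2 = (q : ℝ)⁻¹ := by
    rw [← norm_pow, hsq, norm_intCast_eq q K, hd]
  have hq2 : (2 : ℝ) ≤ q := by exact_mod_cast hq.out.two_le
  have hqi : (q : ℝ)⁻¹ ≤ 2⁻¹ := by
    rw [inv_le_inv₀ (by linarith) (by norm_num)]; exact hq2
  have hρ0 : 0 ≤ ‖ρ‖ := norm_nonneg ρ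
  have hqpos : (0 : ℝ) < (q : ℝ)⁻¹ := by positivity
  refine two_le_ramificationIdx_of_norm_mem_Ioo' q v hv (x := ρ) ?_ ?_
  · -- `‖ρ‖ ≤ q⁻¹` would give `‖ρ‖² ≤ q⁻² < q⁻¹`
    by_contra hle
    rw [not_lt] at hle
    have : ‖ρ‖ ^ 2 ≤ (q : ℝ)⁻¹ * (q : ℝ)⁻¹ := by rw [sq]; exact mul_le_mul hle hle hρ0 hqpos.le
    rw [hn] at this
    nlinarith
  · nlinarith

include hv in
/-- **`F ∋ s` with `s² = d`, `d ≡ 5 (mod 8)` ⇒ `f(v|2) ≥ 2` at EVERY place `v ∣ 2`** (the residue field contains a root of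
`x² + x + 1`). [cite: NeukirchANT1999, Ch. II Prop. (5.3), (6.8)] -/
theorem two_le_inertiaDeg_of_sq_eq_five_mod_eight (hq2 : q = 2) {s : F} {d : ℤ} (hs : s ^ 2 = d) (hd : d % 8 = 5) :
    2 ≤ v.asIdeal.inertiaDeg ℤ := by
  subst hq2
  set K := RescaledCompletion F 2 v hv
  set ρ : K := RescaledCompletion.of F 2 v hv (algebraMap F (v.adicCompletion F) s) with hρdef
  have hsq : ρ ^ 2 = (d : K) := by
    rw [hρdef, ← map_pow, ← map_pow, hs, map_intCast, map_intCast]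
  have hf1 : 1 ≤ v.asIdeal.inertiaDeg ℤ := Ideal.inertiaDeg_pos _ _
  by_contra hlt
  have hf : residueDegree 2 K = 1 := by
    rw [residueDegree_rescaledCompletion F 2 v hv]; omega
  exact not_sq_eq_of_five_mod_eight 2 K rfl hf hd hsq

include hv in
/-- **A quadratic field containing `√3`, at its place over `3`**: `e(v|3) = 2`, `f(v|3) = 1`, and the completion contains NO
primitive cube root of unity (`ζ_3` and `√3` together would give `√−1 = (2ζ_3 + 1)·√3/3` in a field of residue degree `1` over
`ℚ_3`); hence (abc-iut-w5-d039's volume constraint at `m = 0`, `absRamificationIdx_eq_one_of_closedBall_one_eq_zpow_smul_logUnits`)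
**the unit ball of `F_v` is no `3^k·log_3(𝒪_v^×)`** — the shape of `ℚ_3(√3)`, outside the `ℚ_3(ζ_3)`-exception of the census.
[cite: NeukirchANT1999, Ch. II Prop. (5.7), (6.8)] -/
theorem closedBall_one_ne_zpow_smul_logUnits_of_sq_eq_three (hq3 : q = 3) (hF : Module.finrank ℚ F = 2) {s : F}
    (hs : s ^ 2 = ((3 : ℤ) : F)) (k : ℤ) :
    closedBall (0 : RescaledCompletion F q v hv) 1 ≠
      ((q : ℚ_[q]) ^ k) • (logUnits (RescaledCompletion F q v hv) : Set (RescaledCompletion F q v hv)) := by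
  subst hq3
  set K := RescaledCompletion F 3 v hv
  set ρ : K := RescaledCompletion.of F 3 v hv (algebraMap F (v.adicCompletion F) s) with hρdef
  have hsq : ρ ^ 2 = ((3 : ℤ) : K) := by
    rw [hρdef, ← map_pow, ← map_pow, hs, map_intCast, map_intCast]
  push_cast at hsq
  -- `e = 2`, `f = 1`
  have he2 : 2 ≤ v.asIdeal.ramificationIdx ℤ :=
    two_le_ramificationIdx_of_sq_eq_of_dvd 3 v hv (d := 3) (by rw [hs]) (dvd_refl _) (by norm_num)
  have hef : v.asIdeal.ramificationIdx ℤ * v.asIdeal.inertiaDeg ℤ ≤ 2 := by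
    -- one term of `Σ_{w ∣ 3} e_w f_w = [F : ℚ] = 2`
    have hmem : v ∈ placesOver F 3 := (mem_placesOver_iff v).mpr (liesOver_span_of_natCast_mem F 3 v hv)
    have h := Finset.single_le_sum (f := fun w => localDeg F w) (fun w _ => Nat.zero_le _) hmem
    rw [sum_localDeg F 3, hF] at h
    exact h
  have hf1 : 1 ≤ v.asIdeal.inertiaDeg ℤ := Ideal.inertiaDeg_pos _ _
  have he : v.asIdeal.ramificationIdx ℤ = 2 := by nlinarith
  have hf : v.asIdeal.inertiaDeg ℤ = 1 := by nlinarith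
  have heK : absRamificationIdx 3 K = 2 := by rw [absRamificationIdx_rescaledCompletion F 3 v hv, he]
  have hfK : residueDegree 3 K = 1 := by rw [residueDegree_rescaledCompletion F 3 v hv, hf]
  -- no `ζ_3` in `K`
  have h3 : ‖(3 : K)‖ = 3⁻¹ := by exact_mod_cast norm_prime 3 K
  have h30 : (3 : K) ≠ 0 := fun h => by rw [h, norm_zero] at h3; norm_num at h3
  have hm : torsionPExp 3 K = 0 := by
    by_contra hm0
    have hm1 : 1 ≤ torsionPExp 3 K := Nat.pos_of_ne_zero hm0
    obtain ⟨ζ, hζ⟩ := exists_isPrimitiveRoot_pow_torsionPExp 3 K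
    have hpow : 3 ^ torsionPExp 3 K = 3 ^ (torsionPExp 3 K - 1) * 3 := by
      rw [← pow_succ, Nat.sub_add_cancel hm1]
    have hζ3 : IsPrimitiveRoot (ζ ^ 3 ^ (torsionPExp 3 K - 1)) 3 := hζ.pow (pow_pos (by norm_num) _) hpow
    set μ : K := ζ ^ 3 ^ (torsionPExp 3 K - 1) with hμdef
    have hμ1 : μ ≠ 1 := hζ3.ne_one (by norm_num)
    have hμ3 : μ ^ 3 = 1 := hζ3.pow_eq_one
    have hcyc : μ ^ 2 + μ + 1 = 0 := by
      have h0 : (μ - 1) * (μ ^ 2 + μ + 1) = 0 := by linear_combination hμ3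
      rcases mul_eq_zero.mp h0 with h | h
      · exact absurd (sub_eq_zero.mp h) hμ1
      · exact h
    -- `u = (2μ + 1)·ρ/3` has `u² = −1`
    set u : K := (2 * μ + 1) * ρ / 3 with hudef
    have hu : u ^ 2 = -1 := by
      have h9 : ((2 * μ + 1) * ρ) ^ 2 = -9 := by
        rw [mul_pow, hsq]; linear_combination (12 : K) * hcyc
      have h90 : (9 : K) ≠ 0 := by rw [show (9 : K) = 3 * 3 by norm_num]; exact mul_ne_zero h30 h30
      rw [hudef, div_pow, h9, show ((3 : K)) ^ 2 = 9 by norm_num, div_eq_iff h90]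
      norm_num
    exact not_sq_eq_neg_one_three 3 K rfl hfK hu
  intro hk
  have h1 := (absRamificationIdx_eq_one_of_closedBall_one_eq_zpow_smul_logUnits 3 K hm
    (by simpa only [Nat.cast_ofNat] using hk)).1
  omega

end Place

end GenuinePinsResidual

end Summit.ABC.IUTFork.Joshi

end
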